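import Literature.Geometry.Kaehler.ComplexTorusKaehlerLieAlgebraComplexification
import Literature.Algebra.Lie.LefschetzTripleTransport
import HarnessLib

/-!
# Looijenga–Lunts (3.4) over `ℝ`: `(𝔤_K(X; ℝ), h)` and `(𝔰𝔲(V ⊕ V̄^*), u)` are Jordan–Lefschetz pairs for every complex torus `X`

Topic `Literature/Geometry/Kaehler` (namespace `Literature.Geometry.Kaehler.ComplexTorus`, continued).  Lane
`lit-hodgefound` (Track 2 foundations library), skeleton seat `lit-hodgefound-skel-1` (generation 52), row **A1-210** of
`run/shared/lean/pub/lit-hodgefound/SKELETON.md`.  Row A1-44 defined the Kähler Lie algebra `𝔤_K(X; ℝ)` of the complex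
torus `X = V/Λ` as the real Lie subalgebra of `𝔤𝔩(H•(X, ℂ))` generated by the Lefschetz operators `L_η` of the real
`(1,1)`-forms `η` and the partners `Λ` of their `𝔰𝔩₂`-triples `(L_η, h, Λ)` (`h = countingG`, the counting
operator), and identified it with `𝔰𝔲(V ⊕ V̄^*)` (`kaehlerLieAlgebraEquiv : suSo ≃ 𝔤_K`, `u ↦ h`;
`suSoEquivSu : suSo ≃ 𝔰𝔲`); the complexification file proved `𝔤_K` semisimple and "it inherits a grading with
degrees `-2`, `0` and `2`" inside `𝔰𝔲` (`eq_zero_of_lie_gradingElement_eq_smul`); row A1-209 proved the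
COMPLEXIFIED Jordan–Lefschetz clause.  This file proves the clause AS PRINTED, over `ℝ`:

* **`(𝔤_K(X; ℝ), h)` is a Jordan–Lefschetz pair** (`Literature.Algebra.Lie.IsJordanLefschetzPair ℝ`, row A1-84) for
  every complex torus of dimension `n ≥ 1` (`isJordanLefschetzPair_kaehlerLieAlgebra`): semisimple; `𝔞 = 𝔤_2` is
  abelian because `𝔤_4 = 0`; the standard Kähler form `ω₀` gives the triple `(L_{ω₀}, h, Λ_{ω₀})` INSIDE `𝔤_K`; and
  `𝔤_K` is generated by `𝔤_2 ∪ f(dom f)` — which is its very definition, since every `L_η` lies in `𝔤_2` and every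
  partner `Λ` lies in the image of `f`;
* **"In fact, `(𝔰𝔲(V ⊕ V̄^*), u)` is a Jordan–Lefschetz pair"** (`isJordanLefschetzPair_su`), transported along
  `𝔰𝔲(V ⊕ V̄^*) ≅ 𝔤_K(X; ℝ)`, `u ↦ h` (row A1-87 `IsJordanLefschetzPair.map`).

THEOREMS ONLY (no definition, no named fact, no `sorry`; net debt `0`).  No local instance attribute: the Lie
structure of the ambient `𝔤𝔩(H•(X, ℂ))` is supplied inside proofs only (`letI … LieRing.ofAssociativeRing`), all
statements live in the subalgebras `↥𝔤_K`, `↥𝔰𝔲` whose Lie structures are found by unification.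

## Source, VERBATIM

E. Looijenga, V. A. Lunts, *A Lie algebra attached to a projective variety*, Invent. Math. **129** (1997) 361–412 (held
TeX `paper:arxiv-alg-geom_9604014`), §3 p. 13 L117–L127: "We now assume that `X` comes with a complex structure.  We
shall determine its Kähler Lie algebra.  Let `V^*` resp. `V̄^*` denote the `ℝ`-dual of `V` equipped with the complex
structure `J^*` resp. `-J^*`.  The quadratic form `q` defined above is invariant under the complex structure `(J, -J^*)`
and so extends to a Hermitian form on `V ⊕ V̄^*`.  Let `𝔰𝔲(V ⊕ V^*)` be the Lie algebra of the corresponding special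
unitary group.  Since `u ∈ 𝔰𝔲(V ⊕ V̄^*)`, it inherits a grading with degrees `-2`, `0` and `2`.  In fact,
`(𝔰𝔲(V ⊕ V̄^*), u)` is a Jordan–Lefschetz pair.  It is a real form of case `(A_{2n-1}, A_{n-1}+A_{n-1})`.";
(3.4) Proposition, p. 14 L1–L3: "There is a natural identification `(𝔤_K(X; ℝ), h) ≅ (𝔰𝔲(V ⊕ V̄^*), u)`; this is a
real form of the case `(A_{2n-1}, A_{n-1}+A_{n-1})`."; §1 p. 7 L54–L78 (Lefschetz triples: "(i) … for `e` in the
domain of `f`, we have an `𝔰𝔩(2)`-triple `(e, h, f_e)` and (ii) `𝔤` is as a Lie algebra generated by `𝔞` and the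
image of `f`"); §2 p. 9 L109–L111 ("a Lefschetz pair `(𝔤, h)` is a Jordan–Lefschetz pair if `(𝔤, h, 𝔤₂)` is a
Lefschetz triple").

## Contents (all proved; `n = dim_ℂ V ≥ 1`)

* §1 `suSoEquivSu_symm_trans_kaehlerLieAlgebraEquiv_gradingElement` (`𝔰𝔲 ≅ 𝔤_K` carries `u` to `h`);
* §2 **`adDegree_kaehlerLieAlgebra_eq_bot`** (`𝔤_c(h) = 0` for `c ∉ {-2, 0, 2}`),
  **`lie_eq_zero_of_mem_adDegree_two_kaehlerLieAlgebra`** (`𝔤_2` abelian);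
* §3 `lefschetzG_mem_adDegree_two_kaehlerLieAlgebra` (`L_η ∈ 𝔤_2`), `isSl2Triple_kaehlerLieAlgebra` (`(L_η, h, Λ_η)`
  is an `𝔰𝔩₂`-triple INSIDE `𝔤_K`), `lefschetzG_mem_lefschetzDomain_kaehlerLieAlgebra` (the domain of `f` is
  non-empty);
* §4 **`lieSpan_adDegree_two_union_lefschetzDuals_kaehlerLieAlgebra`** (generation by `𝔤_2 ∪ f(dom f)`),
  **`isJordanLefschetzPair_kaehlerLieAlgebra`**, `isLefschetzPair_kaehlerLieAlgebra`, **`isJordanLefschetzPair_su`**,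
  `isLefschetzPair_su`.

## SCOPE (what is NOT formalised here)

"It is a real form of case `(A_{2n-1}, A_{n-1}+A_{n-1})`" is row A1-209 (`isJordanLefschetzPair_baseChange_kaehlerLieAlgebra`
with `kaehlerLieAlgebraComplexification : ℂ ⊗_ℝ 𝔤_K ≅ 𝔰𝔩_ℂ(V ⊕ V̄^*)`); the fundamental-module clause of (3.4) is row
A1-45's.  Nothing here concerns the Hodge conjecture.

## References

* [LooijengaLunts1997] E. Looijenga, V. A. Lunts, *A Lie algebra attached to a projective variety*, Invent. Math. 129
  (1997) 361–412; arXiv:alg-geom/9604014. §1 p. 7, §2 p. 9, §3 p. 13, (3.4) p. 14 (held `paper:arxiv-alg-geom_9604014`).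
-/

namespace Literature.Geometry.Kaehler.ComplexTorus

open Module Function Literature.Algebra.Lie Literature.LinearAlgebra.Alternating

variable (E : Type*) [NormedAddCommGroup E] [NormedSpace ℂ E] [FiniteDimensional ℂ E] [Nontrivial E]

/-! ### §1 `𝔰𝔲(V ⊕ V̄^*) ≅ 𝔤_K(X; ℝ)` carries `u` to `h` -/

/-- The identification `𝔰𝔲(V ⊕ V̄^*) ≅ 𝔤_K(X; ℝ)` (tree `suSoEquivSu`, `kaehlerLieAlgebraEquiv`) carries the grading
element `u = (-1_V, 1_{V^*})` to the counting operator `h`. [cite: LooijengaLunts1997, §3 (3.4) p. 14 L1–L3 ("(𝔤_K(X;ℝ), h) ≅ (𝔰𝔲(V ⊕ V̄^*), u)")] -/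
theorem suSoEquivSu_symm_trans_kaehlerLieAlgebraEquiv_gradingElement :
    ((suSoEquivSu E).symm.trans (kaehlerLieAlgebraEquiv E)) ⟨gradingElement E, gradingElement_mem_su E⟩ =
      (⟨countingG E, countingG_mem_kaehlerLieAlgebra' E⟩ : kaehlerLieAlgebra E) := by
  have h0 : suSoEquivSu E ⟨⟨gradingElement E, gradingElement_mem_so E⟩, gradingElement_mem_su E⟩ =
      ⟨gradingElement E, gradingElement_mem_su E⟩ := Subtype.ext rfl
  have h1 : (suSoEquivSu E).symm ⟨gradingElement E, gradingElement_mem_su E⟩ =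
      (⟨⟨gradingElement E, gradingElement_mem_so E⟩, gradingElement_mem_su E⟩ : suSo E) := by
    rw [← h0, LieEquiv.symm_apply_apply]
  rw [LieEquiv.trans_apply, h1]
  exact Subtype.ext (kaehlerLieAlgebraEquiv_gradingElement (E := E))

/-! ### §2 Only the degrees `-2, 0, 2` occur in `(𝔤_K(X; ℝ), h)`; `𝔤_2` is abelian -/

/-- **`𝔤_c(h) = 0` in `𝔤_K(X; ℝ)` for `c ∉ {-2, 0, 2}`** ("it inherits a grading with degrees `-2`, `0` and `2`"),
transported from `𝔰𝔲(V ⊕ V̄^*)` (tree `eq_zero_of_lie_gradingElement_eq_smul`). [cite: LooijengaLunts1997, §3 p. 13 L123–L125 ("Since u ∈ 𝔰𝔲(V ⊕ V̄^*), it inherits a grading with degrees −2, 0 and 2")] -/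
theorem adDegree_kaehlerLieAlgebra_eq_bot {c : ℝ} (h2 : c ≠ 2) (h0 : c ≠ 0) (hn2 : c ≠ -2) :
    adDegree ℝ (⟨countingG E, countingG_mem_kaehlerLieAlgebra' E⟩ : kaehlerLieAlgebra E) c = ⊥ := by
  have hsu : adDegree ℝ (⟨gradingElement E, gradingElement_mem_su E⟩ : su E) c = ⊥ :=
    (Submodule.eq_bot_iff _).2 fun T hT ↦
      eq_zero_of_lie_gradingElement_eq_smul (su_le_un E) (gradingElement_mem_su E) h2 h0 hn2 (mem_adDegree_iff.1 hT)
  rw [← suSoEquivSu_symm_trans_kaehlerLieAlgebraEquiv_gradingElement E, ← map_adDegree, hsu, Submodule.map_bot]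

/-- **`𝔤_2` is abelian** (`[𝔤_2, 𝔤_2] ⊆ 𝔤_4 = 0`). [cite: LooijengaLunts1997, §2 (2.2) p. 9 L116 ("If e ∈ 𝔤₂ is a Lefschetz element, then [e, 𝔤₂] = 0"), §3 p. 13 L125–L126] -/
theorem lie_eq_zero_of_mem_adDegree_two_kaehlerLieAlgebra {a b : kaehlerLieAlgebra E}
    (ha : a ∈ adDegree ℝ (⟨countingG E, countingG_mem_kaehlerLieAlgebra' E⟩ : kaehlerLieAlgebra E) 2)
    (hb : b ∈ adDegree ℝ (⟨countingG E, countingG_mem_kaehlerLieAlgebra' E⟩ : kaehlerLieAlgebra E) 2) : ⁅a, b⁆ = 0 := by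
  have h := lie_mem_adDegree ha hb
  rw [show (2 : ℝ) + 2 = 4 by norm_num, adDegree_kaehlerLieAlgebra_eq_bot E (by norm_num) (by norm_num) (by norm_num),
    Submodule.mem_bot] at h
  exact h

/-! ### §3 The `𝔰𝔩₂`-triples `(L_η, h, Λ_η)` inside `𝔤_K(X; ℝ)` -/

variable {E} in
/-- `L_η ∈ 𝔤_2` for every real `(1,1)`-form `η` (`[h, L_η] = 2 L_η`: `L_η` raises the degree by `2`). [cite: LooijengaLunts1997, §1 (1.1) p. 3 L106–L111, §3 (3.4)] -/
theorem lefschetzG_mem_adDegree_two_kaehlerLieAlgebra {η : E [⋀^Fin 2]→L[ℝ] ℝ}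
    (hη : ∀ u v : E, η ![Complex.I • u, Complex.I • v] = η ![u, v]) :
    (⟨lefschetzG η, lefschetzG_mem_kaehlerLieAlgebra hη⟩ : kaehlerLieAlgebra E) ∈
      adDegree ℝ (⟨countingG E, countingG_mem_kaehlerLieAlgebra' E⟩ : kaehlerLieAlgebra E) 2 := by
  rw [mem_adDegree_iff]
  apply Subtype.ext
  change ⁅countingG E, lefschetzG η⁆ = (2 : ℝ) • lefschetzG η
  rw [lie_countingG_lefschetzG, two_smul, two_smul]

variable {E} in
/-- The `𝔰𝔩₂`-triple `(L_η, h, Λ_η)` of a non-degenerate real `(1,1)`-form `η` is an `𝔰𝔩₂`-triple INSIDE the Lie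
algebra `𝔤_K(X; ℝ)`. [cite: LooijengaLunts1997, §1 (1.1) p. 4 L1–L5, §3 (3.4)] -/
theorem isSl2Triple_kaehlerLieAlgebra {η : E [⋀^Fin 2]→L[ℝ] ℝ} (hη : ∀ u v : E, η ![Complex.I • u, Complex.I • v] = η ![u, v])
    (hnd : ∀ v : E, v ≠ 0 → ∃ w : E, η ![v, w] ≠ 0) :
    IsSl2Triple (⟨countingG E, countingG_mem_kaehlerLieAlgebra' E⟩ : kaehlerLieAlgebra E)
      ⟨lefschetzG η, lefschetzG_mem_kaehlerLieAlgebra hη⟩ ⟨lefschetzDualG η, lefschetzDualG_mem_kaehlerLieAlgebra hη hnd⟩ := by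
  letI : LieRing (Module.End ℂ (GForm E ℂ)) := LieRing.ofAssociativeRing
  have t := isSl2Triple hnd
  exact
    { h_ne_zero := fun h0 ↦ countingG_ne_zero (E := E) (congrArg Subtype.val h0)
      lie_e_f := Subtype.ext t.lie_e_f
      lie_h_e_nsmul := Subtype.ext t.lie_h_e_nsmul
      lie_h_f_nsmul := Subtype.ext t.lie_h_f_nsmul }

/-- The domain of `f` on `𝔞 = 𝔤_2` is non-empty: the standard Kähler form `ω₀` of the complex structure gives the
triple `(L_{ω₀}, h, Λ_{ω₀})`. [cite: LooijengaLunts1997, §1 p. 7 L54–L66 (Lefschetz triple (i)), §3 (3.4)] -/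
theorem lefschetzG_mem_lefschetzDomain_kaehlerLieAlgebra :
    (⟨lefschetzG (frameForm (cxFrame E)), lefschetzG_mem_kaehlerLieAlgebra (frameForm_cxFrame_I_smul E)⟩ :
        kaehlerLieAlgebra E) ∈
      lefschetzDomain ℝ (⟨countingG E, countingG_mem_kaehlerLieAlgebra' E⟩ : kaehlerLieAlgebra E)
        (adDegree ℝ (⟨countingG E, countingG_mem_kaehlerLieAlgebra' E⟩ : kaehlerLieAlgebra E) 2) :=
  mem_lefschetzDomain_iff.2 ⟨lefschetzG_mem_adDegree_two_kaehlerLieAlgebra (frameForm_cxFrame_I_smul E),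
    _, isSl2Triple_kaehlerLieAlgebra (frameForm_cxFrame_I_smul E) (frameForm_nondegenerate (cxFrame E))⟩

/-! ### §4 `(𝔤_K(X; ℝ), h)` is a Jordan–Lefschetz pair over `ℝ` -/

/-- **Generation**: `𝔤_K(X; ℝ)` is generated by `𝔤_2` and the partners `Λ` of its Lefschetz elements — indeed it is
DEFINED (row A1-44) as the Lie algebra generated by the `L_η` (`η` a real `(1,1)`-form; these lie in `𝔤_2`) and the
`Λ` of the `𝔰𝔩₂`-triples `(L_η, h, Λ)` (these lie in the image of `f`). [cite: LooijengaLunts1997, §1 p. 7 L64–L66 ("𝔤 is as a Lie algebra generated by 𝔞 and the image of f"), (1.1) p. 4 L34–L37, §3 (3.4)] -/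
theorem lieSpan_adDegree_two_union_lefschetzDuals_kaehlerLieAlgebra :
    LieSubalgebra.lieSpan ℝ (kaehlerLieAlgebra E)
        ((adDegree ℝ (⟨countingG E, countingG_mem_kaehlerLieAlgebra' E⟩ : kaehlerLieAlgebra E) 2 :
            Set (kaehlerLieAlgebra E)) ∪
          lefschetzDuals ℝ (⟨countingG E, countingG_mem_kaehlerLieAlgebra' E⟩ : kaehlerLieAlgebra E)
            (adDegree ℝ (⟨countingG E, countingG_mem_kaehlerLieAlgebra' E⟩ : kaehlerLieAlgebra E) 2)) = ⊤ := by
  letI : LieRing (Module.End ℂ (GForm E ℂ)) := LieRing.ofAssociativeRing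
  set hK : kaehlerLieAlgebra E := ⟨countingG E, countingG_mem_kaehlerLieAlgebra' E⟩ with hhK
  set S := LieSubalgebra.lieSpan ℝ (kaehlerLieAlgebra E)
    ((adDegree ℝ hK 2 : Set (kaehlerLieAlgebra E)) ∪ lefschetzDuals ℝ hK (adDegree ℝ hK 2)) with hS
  -- the image of `S` in `𝔤𝔩(H•(X, ℂ))` contains the generators of `𝔤_K`
  have hle : kaehlerLieAlgebra E ≤ S.map (kaehlerLieAlgebra E).incl := by
    refine LieSubalgebra.lieSpan_le.2 ?_
    rintro T ⟨η, hη, hT⟩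
    rcases hT with rfl | t
    · exact ⟨⟨lefschetzG η, lefschetzG_mem_kaehlerLieAlgebra hη⟩,
        LieSubalgebra.subset_lieSpan (Or.inl (lefschetzG_mem_adDegree_two_kaehlerLieAlgebra hη)), rfl⟩
    · have t' : IsSl2Triple hK ⟨lefschetzG η, lefschetzG_mem_kaehlerLieAlgebra hη⟩
          ⟨T, mem_kaehlerLieAlgebra_of_isSl2Triple hη t⟩ :=
        { h_ne_zero := fun h0 ↦ countingG_ne_zero (E := E) (congrArg Subtype.val h0)
          lie_e_f := Subtype.ext t.lie_e_f
          lie_h_e_nsmul := Subtype.ext t.lie_h_e_nsmul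
          lie_h_f_nsmul := Subtype.ext t.lie_h_f_nsmul }
      exact ⟨⟨T, mem_kaehlerLieAlgebra_of_isSl2Triple hη t⟩,
        LieSubalgebra.subset_lieSpan (Or.inr (mem_lefschetzDuals_iff.2
          ⟨_, lefschetzG_mem_adDegree_two_kaehlerLieAlgebra hη, t'⟩)), rfl⟩
  refine eq_top_iff.2 fun x _ ↦ ?_
  obtain ⟨y, hy, hyx⟩ := hle x.2
  have hyx' : y = x := Subtype.ext hyx
  rw [← hyx']
  exact hy

/-- **Looijenga–Lunts (3.4): `(𝔤_K(X; ℝ), h)` IS A JORDAN–LEFSCHETZ PAIR over `ℝ`** for every complex torus `X` of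
dimension `n ≥ 1` — semisimple (tree `isSemisimple_kaehlerLieAlgebra`), `𝔞 = 𝔤_2` abelian (§2), the triple
`(L_{ω₀}, h, Λ_{ω₀})` (§3), and generated by `𝔤_2` and the `Λ`'s (by definition of `𝔤_K`, §4).  Type
`(A_{2n-1}, A_{n-1}+A_{n-1})` after complexification (row A1-209). [cite: LooijengaLunts1997, §3 p. 13 L123–L127 ("In fact, (𝔰𝔲(V ⊕ V̄^*), u) is a Jordan–Lefschetz pair. It is a real form of case (A_{2n−1}, A_{n−1}+A_{n−1})"), (3.4) p. 14 L1–L3] -/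
theorem isJordanLefschetzPair_kaehlerLieAlgebra :
    IsJordanLefschetzPair ℝ (⟨countingG E, countingG_mem_kaehlerLieAlgebra' E⟩ : kaehlerLieAlgebra E) :=
  ⟨isSemisimple_kaehlerLieAlgebra E, le_rfl, fun _ ha _ hb ↦ lie_eq_zero_of_mem_adDegree_two_kaehlerLieAlgebra E ha hb,
    ⟨_, lefschetzG_mem_lefschetzDomain_kaehlerLieAlgebra E⟩,
    lieSpan_adDegree_two_union_lefschetzDuals_kaehlerLieAlgebra E⟩

/-- Hence `(𝔤_K(X; ℝ), h)` is a Lefschetz pair. [cite: LooijengaLunts1997, §1 p. 7 L77–L78, §3 (3.4)] -/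
theorem isLefschetzPair_kaehlerLieAlgebra :
    IsLefschetzPair ℝ (⟨countingG E, countingG_mem_kaehlerLieAlgebra' E⟩ : kaehlerLieAlgebra E) :=
  (isJordanLefschetzPair_kaehlerLieAlgebra E).isLefschetzPair

/-- **"In fact, `(𝔰𝔲(V ⊕ V̄^*), u)` is a Jordan–Lefschetz pair"** — transported along
`𝔰𝔲(V ⊕ V̄^*) ≅ 𝔤_K(X; ℝ)`, `u ↦ h` (row A1-87 `IsJordanLefschetzPair.map`). [cite: LooijengaLunts1997, §3 p. 13 L125–L127] -/
theorem isJordanLefschetzPair_su :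
    IsJordanLefschetzPair ℝ (⟨gradingElement E, gradingElement_mem_su E⟩ : su E) := by
  have J := (isJordanLefschetzPair_kaehlerLieAlgebra E).map ((suSoEquivSu E).symm.trans (kaehlerLieAlgebraEquiv E)).symm
  rwa [← suSoEquivSu_symm_trans_kaehlerLieAlgebraEquiv_gradingElement E, LieEquiv.symm_apply_apply] at J

/-- `(𝔰𝔲(V ⊕ V̄^*), u)` is a Lefschetz pair. [cite: LooijengaLunts1997, §3 p. 13 L125–L127] -/
theorem isLefschetzPair_su : IsLefschetzPair ℝ (⟨gradingElement E, gradingElement_mem_su E⟩ : su E) :=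
  (isJordanLefschetzPair_su E).isLefschetzPair

end Literature.Geometry.Kaehler.ComplexTorus
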